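import Summits.FinalStateConjecture.FinalStateConjecture.Theorems.PhotonSphereChannelsChannelsResolveTameDevelopmentsRKerrLocusReduction
import Summits.FinalStateConjecture.FinalStateConjecture.Theorems.PhotonSphereChannelsChannelsResolveTameDevelopmentsRKerrParametersConstantAlong
import Summits.FinalStateConjecture.FinalStateConjecture.Theorems.EIHFluxBalanceInertialRecessionPullback
import Summits.FinalStateConjecture.FinalStateConjecture.Theorems.ZeroEnergyRigidity.Negative.KerrParameterSign
import HarnessLib

/-!
# Route PhotonSphereChannels · crux `ChannelsResolveTameDevelopmentsR` (K2R-T2, stmt-FinalStateConjecture-17430) —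
# the spin flip (S) `KerrDocSpinFlipOn`, proved: an exact Kerr `(M, a)` region is an exact Kerr `(M, −a)` region

Input (S) of the reductions of stub K (`…RKerrLocusReduction.lean`, `kerrDocParamClosedOn_of_unique_of_flip`) and of stub
K♭ (`…RKerrParametersConstantAlong.lean`, both routes) of the lines `dark-future-exactness` / `tame-lasalle-dock`:
`DarkFuture.KerrDocSpinFlipOn 𝓢 O := ∀ M a, IsKerrDoc 𝓢 O M a → IsKerrDoc 𝓢 O M (-a)`. This file DISCHARGES it for every
spacetime and every region (`kerrDocSpinFlipOn`), by the reflection `σ : (t*, x, y, z) ↦ (t*, x, −y, z)` of the ingoing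
Kerr–Schild chart:

* §1 `σ = reflY`, the continuous linear involution of `E4` of the landed tightness lemma
  `…Theorems.ZeroEnergyRigidity.Negative.KerrParameterSign` (REUSED: `reflY_reflY`, `radius_reflY`, `radius_neg`,
  `bilin_neg_reflY` — `g_{M,−a}(σx)(σv, σw) = g_{M,a}(x)(v, w)` —, `reflY_mem_exterior`); added here: the bilinear-form
  packaging `g_{M,a}(σx)[σ ·, σ ·] = g_{M,−a}(x)` (`bilin_bilinearComp_reflY`), `σ ∂_{t*} = ∂_{t*}`, and the exterior
  `(M, a) → (M, −a)` direction.
* §2 Given an exact `(M, a)` chart `Ψ` of `O`, the re-charted map `Ψ ∘ σ` is an exact `(M, −a)` chart of `O`: injective,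
  smooth, same range, deviation `0` by the re-charting identity `deviation_comp_smooth'` (landed,
  `…Theorems.EIHFluxBalanceInertialRecessionPullback`) and §1, and future-oriented outside the ergoregion since `σ ∂_{t*} =
  ∂_{t*}` (`mfderiv_comp_smooth_apply`).
* §3 The reductions with (S) discharged: (C) ⇐ (U) for stub K (`kerrDocParamClosedOn_of_unique`); K♭'s registered text
  from unique pinning (UP) ALONE (`kerrParametersConstantAlong_of_uniquePinning'`), and from (B1)+(B2)+(B4)+(U)
  (`kerrParametersConstantAlong_of_closedLoci_of_pinned_of_unique'`).

References: Kerr–Schild 1965 (the form `η + 2H ℓ ⊗ ℓ`) [KerrSchild1965]; M. Visser, arXiv:0706.0622, (32)–(35)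
[arXiv07060622]; Dafermos–Luk 2017, Conjecture 1 (the role of `(M, a)` up to isometry) [DafermosLuk2017].
-/

noncomputable section

-- the operator-norm instance on `E4 →L[ℝ] E4 →L[ℝ] ℝ` needs one more level of pending
-- instance problems than the default (as in `PhotonSphereChannelsTameHullDefs.lean`)
set_option maxSynthPendingDepth 3
-- every `Summit.FinalStateConjecture.FinalStateConjecture.…` name repeats the summit = sub-problem segment (D-0017 layout)
set_option linter.dupNamespace false

open Set Filter Function TopologicalSpace Manifold Bundle
open scoped Topology Manifold ContDiff ENNReal NNReal

namespace Summit.FinalStateConjecture.FinalStateConjecture.Theorems.TameLaSalle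

open Literature.Geometry.Lorentzian
open Summit.FinalStateConjecture.FinalStateConjecture.Theorems.TameHull
open Summit.FinalStateConjecture.FinalStateConjecture.Theorems.DarkFuture

/-! ### §1 The reflection `y ↦ −y` (`reflY`) and the Kerr–Schild data -/

namespace SpinFlip

open Summit.FinalStateConjecture.FinalStateConjecture.Theorems.ZeroEnergyRigidity.Negative

/-- `σ ∂_{t*} = ∂_{t*}` for the reflection `σ = reflY : (t*, x, y, z) ↦ (t*, x, −y, z)`. [folklore] -/
theorem reflY_basisVector_zero : reflY (E4.basisVector 0) = E4.basisVector 0 := by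
  ext μ
  fin_cases μ <;> simp [reflY_apply]

/-- **The Kerr–Schild form is reflected into its spin flip**, as an identity of bilinear forms:
`g_{M,a}(σx)[σ ·, σ ·] = g_{M,−a}(x)` (`bilin_neg_reflY` at `−a`). Kerr–Schild 1965; Visser arXiv:0706.0622, (32)–(35).
[cite: KerrSchild1965] -/
theorem bilin_bilinearComp_reflY (M a : ℝ) (x : E4) :
    (Kerr.bilin M a (reflY x)).bilinearComp reflY reflY = Kerr.bilin M (-a) x := by
  refine ContinuousLinearMap.ext fun v ↦ ContinuousLinearMap.ext fun w ↦ ?_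
  rw [ContinuousLinearMap.bilinearComp_apply]
  have h := bilin_neg_reflY M (-a) x v w
  rwa [neg_neg] at h

/-- `σ` maps the Kerr `(M, a)` exterior into the Kerr `(M, −a)` exterior (`reflY_mem_exterior` at `−a`). [folklore] -/
theorem reflY_mem_exterior_neg {M a : ℝ} {x : E4} (hx : x ∈ Kerr.exterior M a) : reflY x ∈ Kerr.exterior M (-a) := by
  have h := @reflY_mem_exterior M (-a) x
  rw [neg_neg] at h
  exact h hx

end SpinFlip

open SpinFlip Summit.FinalStateConjecture.FinalStateConjecture.Theorems.ZeroEnergyRigidity.Negative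

/-! ### §2 (S) proved: the re-charted map `Ψ ∘ σ` -/

/-- **(S) The spin flip on every region, proved** (discharges the input `DarkFuture.KerrDocSpinFlipOn` of the reductions
of stubs K and K♭): if `O ⊆ 𝓢` is an exact Kerr `(M, a)` exterior (`IsKerrDoc 𝓢 O M a`: injective smooth chart `Ψ` of
`Kerr.exterior M a` onto `O` with `Ψ^* g = g_{M,a}`, `Ψ_* ∂_{t*}` future-directed where `r > 2M`), then it is an exact Kerr
`(M, −a)` exterior, via `Ψ ∘ σ` with `σ (t*, x, y, z) = (t*, x, −y, z)`: `(Ψ ∘ σ)^* g = σ^* g_{M,a} = g_{M,−a}`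
(`deviation_comp_smooth'`, `bilin_bilinearComp_reflY`), same range (`σ` is an involution of the exteriors), and
`d(Ψ ∘ σ) ∂_{t*} = dΨ ∂_{t*}` (`σ ∂_{t*} = ∂_{t*}`). [cite: KerrSchild1965] -/
theorem kerrDocSpinFlipOn : ∀ (𝓢 : Spacetime.{0} 4) (O : Set 𝓢.carrier), KerrDocSpinFlipOn 𝓢 O := by
  rintro 𝓢 O M a ⟨Ψ, hinj, hsmooth, hrange, hdev, hfut⟩
  have hf : ContDiff ℝ ∞ (reflY : E4 → E4) := reflY.contDiff
  have hK : ∀ x ∈ (Kerr.background M (-a)).domain, reflY x ∈ (Kerr.background M a).domain :=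
    fun x hx ↦ reflY_mem_exterior hx
  set Ψ' : Kerr.exterior M (-a) → 𝓢.carrier := fun x ↦ Ψ ⟨reflY x.1, hK x.1 x.2⟩
  have hΨ' : ∀ x, Ψ' x = Ψ ⟨reflY x.1, hK x.1 x.2⟩ := fun _ ↦ rfl
  have hfd : ∀ x : E4, fderiv ℝ (reflY : E4 → E4) x = reflY := fun _ ↦ reflY.fderiv
  refine ⟨Ψ', ?_, ?_, ?_, ?_, ?_⟩
  · -- injective
    intro x y hxy
    have h : reflY x.1 = reflY y.1 := congrArg Subtype.val (hinj hxy)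
    exact Subtype.ext (by rw [← reflY_reflY x.1, ← reflY_reflY y.1, h])
  · -- smooth
    exact contMDiff_comp_smooth hf hK hΨ' hsmooth
  · -- range
    apply Subset.antisymm
    · rintro _ ⟨x, rfl⟩
      rw [← hrange]
      exact mem_range_self _
    · intro o ho
      rw [← hrange] at ho
      obtain ⟨y, rfl⟩ := ho
      refine ⟨⟨reflY y.1, reflY_mem_exterior_neg y.2⟩, ?_⟩
      rw [hΨ']
      congr 1
      exact Subtype.ext (reflY_reflY y.1)
  · -- exact: deviation zero
    intro x
    rw [deviation_comp_smooth' (Kerr.background M a) (Kerr.background M (-a)) hf hK hΨ' hsmooth x, hdev, hfd]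
    change (0 : E4 →L[ℝ] E4 →L[ℝ] ℝ).bilinearComp reflY reflY +
      ((Kerr.bilin M a (reflY x.1)).bilinearComp reflY reflY - Kerr.bilin M (-a) x.1) = 0
    rw [bilin_bilinearComp_reflY, sub_self, add_zero]
    exact ContinuousLinearMap.ext fun v ↦ ContinuousLinearMap.ext fun w ↦ rfl
  · -- future-oriented outside the ergoregion
    intro x hx
    have hx' : 2 * M < Kerr.radius a (reflY x.1) := by rwa [radius_reflY, ← radius_neg]
    have key := mfderiv_comp_smooth_apply hf hK hΨ' hsmooth x (E4.basisVector 0)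
    have h3 : fderiv ℝ (reflY : E4 → E4) x.1 (E4.basisVector 0) = E4.basisVector 0 := by
      rw [hfd, reflY_basisVector_zero]
    have key' := key.trans
      (congrArg (fun u : E4 ↦ mfderiv 𝓘(ℝ, E4) (𝓡 4) Ψ ⟨reflY x.1, hK x.1 x.2⟩ u) h3)
    have h2 := hfut ⟨reflY x.1, hK x.1 x.2⟩ hx'
    exact (congrArg (fun w ↦ 𝓢.timeOrientation.IsFutureDirected w) key').mpr h2

/-- **(S) for the d.o.c. of every end** (the form consumed by `kerrParametersConstantAlong_of_uniquePinning`,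
`kerrParametersConstantAlong_of_closedLoci_of_pinned_of_unique`, `kerrLocusClopen_of_transport_of_paramClosed`).
[cite: KerrSchild1965] -/
theorem kerrDocSpinFlipOn_doc : ∀ (𝓢 : Spacetime.{0} 4) (E : EndDatum 𝓢), KerrDocSpinFlipOn 𝓢 E.doc :=
  fun 𝓢 E ↦ kerrDocSpinFlipOn 𝓢 E.doc

/-! ### §3 The reductions of K and K♭ with (S) discharged -/

/-- **(C) ⇐ (U) alone** (input (C) `KerrDocParamClosedOn` of the reduction `kerrLocusClopen_of_transport_of_paramClosed` of
stub K): with the spin flip proved, closedness of the sub-extremal Kerr parameters of a region under approximation follows from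
their uniqueness up to the spin sign (`kerrDocParamClosedOn_of_unique_of_flip`). [cite: DafermosLuk2017, Conjecture 1] -/
theorem kerrDocParamClosedOn_of_unique {𝓢 : Spacetime.{0} 4} {O : Set 𝓢.carrier} (hU : KerrDocParamUniqueOn 𝓢 O) :
    KerrDocParamClosedOn 𝓢 O :=
  kerrDocParamClosedOn_of_unique_of_flip hU (kerrDocSpinFlipOn 𝓢 O)

/-- **Stub K♭ from unique pinning (UP) ALONE** (K♭'s registered text VERBATIM as the conclusion; (S) discharged by
`kerrDocSpinFlipOn`): if every development as in Φ, class `(Λ, r₀)` with `0 < r₀` and precompact generator hull, and horizon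
generator path carry unique pinning `KerrParametersUniqueUpToSpinAlong` along the path, then `KerrParametersConstantAlong`
holds. [cite: DafermosLuk2017, Conjecture 1] -/
theorem kerrParametersConstantAlong_of_uniquePinning' : (∀ {X : Type} [TopologicalSpace X] [ChartedSpace E3 X] [IsManifold (𝓡 3) ∞ X] [T2Space X] [SecondCountableTopology X] [ConnectedSpace X] {D : InitialDataSet (𝓡 3) X}, D ∈ admissibleVacuumData X → ∀ (𝒟 : VacuumCauchyDevelopment D) [𝒟.metric.HasLeviCivita], DevHyp 𝒟 → ∀ (Λ : ℕ → ℝ≥0) (r₀ : ℝ), 0 < r₀ → GeneratorHullExists 𝒟 Λ r₀ → ∀ γ : ℝ → 𝒟.carrier, IsHorizonPath 𝒟 γ → KerrParametersUniqueUpToSpinAlong 𝒟 Λ r₀ γ) → ∀ (X : Type) [TopologicalSpace X] [ChartedSpace E3 X] [IsManifold (𝓡 3) ∞ X] [T2Space X] [SecondCountableTopology X] [ConnectedSpace X], ∀ D ∈ admissibleVacuumData X, ∀ (𝒟 : VacuumCauchyDevelopment D) [𝒟.metric.HasLeviCivita], DevHyp 𝒟 → ∀ (Λ : ℕ → ℝ≥0)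 (r₀ : ℝ), 0 < r₀ → GeneratorHullExists 𝒟 Λ r₀ → ∀ γ : ℝ → 𝒟.carrier, IsHorizonPath 𝒟 γ → (∀ (𝓢 : Spacetime.{0} 4) (E : EndDatum 𝓢) (p : 𝓢.carrier), IsHorizonHullElement 𝒟 Λ r₀ γ 𝓢 E p → ∃ M a : ℝ, 0 < M ∧ |a| < M ∧ IsKerrDoc 𝓢 E.doc M a) → ∃ M a : ℝ, 0 < M ∧ |a| < M ∧ ∀ (𝓢 : Spacetime.{0} 4) (E : EndDatum 𝓢) (p : 𝓢.carrier), IsHorizonHullElement 𝒟 Λ r₀ γ 𝓢 E p → IsKerrDoc 𝓢 E.doc M a :=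
  fun hUP ↦ kerrParametersConstantAlong_of_uniquePinning hUP kerrDocSpinFlipOn_doc

/-- **Stub K♭ from (B1)+(B2) hull topology, (B4) pinning and (U) uniqueness** (K♭'s registered text VERBATIM as the
conclusion; (S) discharged by `kerrDocSpinFlipOn`). [cite: Hale1980, Ch. I §8 Thm. 8.1] -/
theorem kerrParametersConstantAlong_of_closedLoci_of_pinned_of_unique' : (∀ {X : Type} [TopologicalSpace X] [ChartedSpace E3 X] [IsManifold (𝓡 3) ∞ X] [T2Space X] [SecondCountableTopology X] [ConnectedSpace X] {D : InitialDataSet (𝓡 3) X}, D ∈ admissibleVacuumData X → ∀ (𝒟 : VacuumCauchyDevelopment D) [𝒟.metric.HasLeviCivita], DevHyp 𝒟 → ∀ (Λ : ℕ → ℝ≥0) (r₀ : ℝ), 0 < r₀ → GeneratorHullExists 𝒟 Λ r₀ → ∀ γ : ℝ → 𝒟.carrier, IsHorizonPath 𝒟 γ → (∃ τ : TopologicalSpace (HullElt 𝒟 Λ r₀ γ), @PreconnectedSpace (HullElt 𝒟 Λ r₀ γ) τ ∧ ∀ M a : ℝ, 0 < M → |a| < M → IsClosed[τ] {Z : HullElt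 𝒟 Λ r₀ γ | IsKerrDoc Z.𝓢 Z.E.doc M a}) ∧ KerrParametersPinnedAlong 𝒟 Λ r₀ γ) → (∀ (𝓢 : Spacetime.{0} 4) (E : EndDatum 𝓢), KerrDocParamUniqueOn 𝓢 E.doc) → ∀ (X : Type) [TopologicalSpace X] [ChartedSpace E3 X] [IsManifold (𝓡 3) ∞ X] [T2Space X] [SecondCountableTopology X] [ConnectedSpace X], ∀ D ∈ admissibleVacuumData X, ∀ (𝒟 : VacuumCauchyDevelopment D) [𝒟.metric.HasLeviCivita], DevHyp 𝒟 → ∀ (Λ : ℕ → ℝ≥0) (r₀ : ℝ), 0 < r₀ → GeneratorHullExists 𝒟 Λ r₀ → ∀ γ : ℝ → 𝒟.carrier, IsHorizonPath 𝒟 γ → (∀ (𝓢 : Spacetime.{0} 4) (E : EndDatum 𝓢) (p : 𝓢.carrier), IsHorizonHullElement 𝒟 Λ r₀ γ 𝓢 E p → ∃ M a : ℝ, 0 < M ∧ |a| < M ∧ IsKerrDoc 𝓢 E.doc M a) → ∃ M a : ℝ, 0 < M ∧ |a| < M ∧ ∀ (𝓢 : Spacetime.{0} 4) (E : EndDatum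 𝓢) (p : 𝓢.carrier), IsHorizonHullElement 𝒟 Λ r₀ γ 𝓢 E p → IsKerrDoc 𝓢 E.doc M a :=
  fun hB hU ↦ kerrParametersConstantAlong_of_closedLoci_of_pinned_of_unique hB hU kerrDocSpinFlipOn_doc

end Summit.FinalStateConjecture.FinalStateConjecture.Theorems.TameLaSalle

end
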